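/-
Copyright: b2b-lace packet (enumeration shard A, gen 10).  The hyperoctahedral symmetry of the SAW counts,
transported to the coded kernel `sawCodeG`: equal kernel values on `W_m`-equivalent states, per fresh-direction
coefficient.  No cell of the record is touched; no fact; no `sorry`.
-/
import Literature.Probability.FitznerVanDerHofstad2017.SawCountKernelG
import HarnessLib

/-!
# `W_m`-symmetry of the coded SAW recursion `sawCodeG`, coefficient by coefficient

CITATION HEADER (PLACEMENT v2). This module is part of a certified REPRODUCTION of:
R. Fitzner, R. van der Hofstad, *Mean-field behavior for nearest-neighbor percolation in d > 10*,
Electron. J. Probab. 22 (2017), no. 43 [FvdH17]; *Generalized approach to the non-backtracking lace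
expansion*, Probab. Theory Related Fields 169 (2017) [NoBLE17-I] (arXiv:1506.07977, 1506.07969).
Reproduces: the notebook input `nrSAW[n,d,x]` (SRW.nb §3).  Here: a SYMMETRY LEMMA for the machine `sawCodeG`
of `SawCountKernelG`, used downstream to evaluate each `W_m`-orbit of recursion states once.

## Statement

A state of the recursion is a current site `y` and the list of previously visited sites, all supported on the
first `m` coordinates; the kernel sees them as codes `C = code D y`, `L = [code D z | z visited]` with the residue
filter `V = pathV L`.  A signed permutation of the first `m` coordinates (data: the source index list `q`, a
permutation of `0, …, m-1`, and the sign list `sg`) maps such a state to another one.  **`sawCodeG_symm`**: the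
two states have the same kernel value `sawCodeG n j m · L1 · ·` for EVERY `j`, under side conditions on the
coordinate lists that `decide` checks (`SymmHyp`, one `Decidable` conjunction).

## Proof

Purely a transport of facts already in the library: (1) the transfer theorem `sawCount_eq_sum_sawCodeG`
(`SawCountKernelG`) at BOTH states, for every ambient dimension `d ≥ m` — here packaged for states given by
coordinate lists (`sawCount_lists_eq_sum`); (2) the `W_d`-invariance of the lattice recursion
`sawCount_signedPerm` (`SawCountRecursion`); (3) the fresh-direction weights `2^j (d-m)^{(j)}`, `j = 0, 1, …`, are
linearly independent as functions of `d ≥ m` (`freshWeight_coeff_eq`, by evaluation at `d = m + j`), so equal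
weighted sums for all `d` force equal coefficients.  No kernel evaluation is involved.

## What is NOT here

No numeral table, no dimension fixed, no cell, no fact, no `sorry`.

## References
* N. Madras, G. Slade, The Self-Avoiding Walk (1993), §1.1–1.2 [folklore recursion and its lattice symmetry].
* R. Fitzner, R. van der Hofstad, SRW.nb (2015) §3, arXiv:1506.07977 anc. (the table reproduced downstream).
-/

namespace Literature.Probability.FitznerVanDerHofstad2017

open Finset Literature.Probability.LatticeModels Literature.Probability.Percolation

variable {d : ℕ}

/-! ### States given by coordinate lists -/

/-- The finite set of sites listed by coordinate lists. [folklore] -/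
def listSet (P : List (List ℤ)) (d : ℕ) : Finset (Site d) := (P.map fun p => siteOfList p d).toFinset

/-- The residue filter of a code list: `pathV [c₁, …, c_k] = nextV c₁ (⋯ (nextV c_k 0))`. [folklore] -/
def pathV : List ℕ → ℕ
  | [] => 0
  | c :: L => nextV c (pathV L)

/-- `pathV L` filters `L`. [folklore] -/
theorem fInv_pathV : ∀ L : List ℕ, FInv (pathV L) L
  | [] => fInv_nil
  | c :: L => by rw [pathV]; exact (fInv_pathV L).cons c

/-- A list of length `≤ d` codes the origin only if all its entries vanish. [folklore] -/
theorem forall_eq_zero_of_siteOfList_eq_zero {p : List ℤ} (hp : p.length ≤ d) (h : siteOfList p d = 0) :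
    ∀ a ∈ p, a = 0 := by
  intro a ha
  obtain ⟨i, hi, rfl⟩ := List.getElem_of_mem ha
  have := congrFun h ⟨i, lt_of_lt_of_le hi hp⟩
  rw [siteOfList_apply, List.getD_eq_getElem _ _ hi] at this
  simpa using this

/-- Membership in `listSet`. [folklore] -/
theorem mem_listSet {P : List (List ℤ)} {z : Site d} : z ∈ listSet P d ↔ ∃ p ∈ P, siteOfList p d = z := by
  simp [listSet]

/-- **Transfer theorem for list-coded states**: `sawCount_eq_sum_sawCodeG` for a current site and a visited set
given by coordinate lists of length `m`, with all side conditions on the lists. [folklore] -/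
theorem sawCount_lists_eq_sum {n m D : ℕ} {l : List ℤ} {P : List (List ℤ)} (hmd : m ≤ d) (hl : l.length = m)
    (hP : ∀ p ∈ P, p.length = m) (hD : m + n ≤ D) (hbox : ∀ a ∈ l, a.natAbs + n < sawR) (hn : n < sawR)
    (hPbox : ∀ p ∈ P, ∀ a ∈ p, a.natAbs < sawR) (hP0 : ∀ p ∈ P, ∃ a ∈ p, a ≠ 0) :
    sawCount d n (siteOfList l d) (listSet P d) =
      ∑ j ∈ range (n + 1), sawCodeG n j m (codeList l D) ((l.map Int.natAbs).sum)
        (pathV (P.map fun p => codeList p D)) (P.map fun p => codeList p D) * freshWeight d m j := by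
  have hld : l.length ≤ d := hl ▸ hmd
  have hPd : ∀ p ∈ P, p.length ≤ d := fun p hp => (hP p hp) ▸ hmd
  have hy : SuppBelow m (siteOfList l d) := hl ▸ suppBelow_siteOfList l d
  have hA : ∀ z ∈ listSet P d, SuppBelow m z := by
    intro z hz
    obtain ⟨p, hp, rfl⟩ := mem_listSet.1 hz
    exact (hP p hp) ▸ suppBelow_siteOfList p d
  have hAbox : ∀ z ∈ listSet P d, InBox z := by
    intro z hz i
    obtain ⟨p, hp, rfl⟩ := mem_listSet.1 hz
    simpa using margin_siteOfList (n := 0) (d := d) (fun a ha => by simpa using hPbox p hp a ha) (by decide) i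
  have h0 : (0 : Site d) ∉ listSet P d := by
    intro hz
    obtain ⟨p, hp, hp0⟩ := mem_listSet.1 hz
    obtain ⟨a, ha, ha0⟩ := hP0 p hp
    exact ha0 (forall_eq_zero_of_siteOfList_eq_zero (hPd p hp) hp0 a ha)
  have hL : ∀ c, memL c (P.map fun p => codeList p D) = true ↔
      c ∈ (listSet P d).image (code D) := by
    intro c
    rw [memL_iff, List.mem_map, mem_image]
    constructor
    · rintro ⟨p, hp, rfl⟩
      exact ⟨siteOfList p d, mem_listSet.2 ⟨p, hp, rfl⟩, code_siteOfList (hPd p hp) D⟩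
    · rintro ⟨z, hz, rfl⟩
      obtain ⟨p, hp, rfl⟩ := mem_listSet.1 hz
      exact ⟨p, hp, (code_siteOfList (hPd p hp) D).symm⟩
  rw [sawCount_eq_sum_sawCodeG D n m (siteOfList l d) (listSet P d) _ _ hmd hy hA hD
      (margin_siteOfList hbox hn) hAbox h0 (fInv_pathV _) hL, code_siteOfList hld, l1Norm_siteOfList hld]

/-! ### Signed permutations of the first `m` coordinates, as list data -/

/-- The action on coordinate lists: position `i < |q|` reads coordinate `q_i`, negated iff `sg_i`. [folklore] -/
def actList (q : List ℕ) (sg : List Bool) (l : List ℤ) : List ℤ :=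
  (List.range q.length).map fun i => (if sg.getD i false then -1 else 1) * l.getD (q.getD i 0) 0

/-- Length of `actList`. [folklore] -/
theorem length_actList (q : List ℕ) (sg : List Bool) (l : List ℤ) : (actList q sg l).length = q.length := by
  simp [actList]

/-- The sign at position `i`, as a unit. [folklore] -/
def sgnUnit (sg : List Bool) (i : ℕ) : ℤˣ := if sg.getD i false then -1 else 1

/-- Entries of `actList` inside the range. [folklore] -/
theorem getD_actList_of_lt {q : List ℕ} (sg : List Bool) (l : List ℤ) {i : ℕ} (hi : i < q.length) :
    (actList q sg l).getD i 0 = (sgnUnit sg i : ℤ) * l.getD (q.getD i 0) 0 := by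
  have hlen : i < (actList q sg l).length := by rw [length_actList]; exact hi
  rw [List.getD_eq_getElem (actList q sg l) 0 hlen]
  unfold sgnUnit
  simp only [actList, List.getElem_map, List.getElem_range]
  split_ifs <;> simp

/-- Entries of `actList` outside the range. [folklore] -/
theorem getD_actList_of_le {q : List ℕ} (sg : List Bool) (l : List ℤ) {i : ℕ} (hi : q.length ≤ i) :
    (actList q sg l).getD i 0 = 0 :=
  List.getD_eq_default _ _ (by rw [length_actList]; exact hi)

/-- **Realisation**: for `q` a permutation of `0, …, m-1` (`|q| = m`, entries `< m`, no duplicates) and `m ≤ d`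
there is a signed permutation of `ℤ^d` acting on every list-coded site of length `m` as `actList q sg`. [folklore] -/
theorem exists_signedPerm_actList {m : ℕ} {q : List ℕ} (sg : List Bool) (hmd : m ≤ d) (hq : q.length = m)
    (hqm : ∀ a ∈ q, a < m) (hnd : q.Nodup) :
    ∃ (π : Equiv.Perm (Fin d)) (ε : Fin d → ℤˣ), ∀ l : List ℤ, l.length = m →
      Site.signedPerm π ε (siteOfList l d) = siteOfList (actList q sg l) d := by
  have hget : ∀ i : ℕ, i < m → q.getD i 0 < m := fun i hi =>
    hqm _ (by rw [List.getD_eq_getElem _ _ (hq ▸ hi)]; exact List.getElem_mem _)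
  let f : Fin d → Fin d := fun i =>
    if h : (i : ℕ) < m then ⟨q.getD i 0, lt_of_lt_of_le (hget i h) hmd⟩ else i
  have hf_lt : ∀ i : Fin d, (i : ℕ) < m → (f i : ℕ) = q.getD i 0 := fun i hi => by
    simp [f, hi]
  have hf_ge : ∀ i : Fin d, ¬ (i : ℕ) < m → f i = i := fun i hi => by simp [f, hi]
  have hinj : Function.Injective f := by
    intro i i' h
    by_cases hi : (i : ℕ) < m <;> by_cases hi' : (i' : ℕ) < m
    · have h1 := hf_lt i hi; have h2 := hf_lt i' hi'
      rw [h] at h1; rw [h1] at h2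
      rw [List.getD_eq_getElem _ _ (hq ▸ hi), List.getD_eq_getElem _ _ (hq ▸ hi')] at h2
      exact Fin.ext ((List.Nodup.getElem_inj_iff hnd).1 h2)
    · exfalso
      have h1 := hf_lt i hi; have h2 := hf_ge i' hi'
      have := hget i hi
      rw [h, h2] at h1; omega
    · exfalso
      have h1 := hf_ge i hi; have h2 := hf_lt i' hi'
      have := hget i' hi'
      rw [← h, h1] at h2; omega
    · rw [hf_ge i hi, hf_ge i' hi'] at h; exact h
  let τ : Equiv.Perm (Fin d) := Equiv.ofBijective f (Finite.injective_iff_bijective.1 hinj)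
  refine ⟨τ.symm, fun i => sgnUnit sg i, fun l hl => ?_⟩
  funext i
  rw [Site.signedPerm_apply, Equiv.symm_symm, Equiv.ofBijective_apply, siteOfList_apply, siteOfList_apply]
  by_cases hi : (i : ℕ) < m
  · rw [hf_lt i hi, getD_actList_of_lt sg l (hq ▸ hi)]
  · rw [hf_ge i hi, List.getD_eq_default l 0 (by rw [hl]; omega), getD_actList_of_le sg l (by rw [hq]; omega)]
    simp

/-- The image of a list-coded set under a map acting listwise. [folklore] -/
theorem image_listSet_of_forall {f : Site d → Site d} {g : List ℤ → List ℤ} {P : List (List ℤ)}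
    (h : ∀ p ∈ P, f (siteOfList p d) = siteOfList (g p) d) :
    (listSet P d).image f = listSet (P.map g) d := by
  ext z
  simp only [mem_image, mem_listSet, List.mem_map]
  constructor
  · rintro ⟨w, ⟨p, hp, rfl⟩, rfl⟩
    exact ⟨g p, ⟨p, hp, rfl⟩, (h p hp).symm⟩
  · rintro ⟨_, ⟨p, hp, rfl⟩, rfl⟩
    exact ⟨siteOfList p d, ⟨p, hp, rfl⟩, h p hp⟩

/-! ### Linear independence of the fresh-direction weights -/

/-- **Coefficient extraction**: if `Σ_{j<N} a_j 2^j (d-m)^{(j)} = Σ_{j<N} b_j 2^j (d-m)^{(j)}` for every `d ≥ m`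
then `a_j = b_j` for all `j < N` (evaluate at `d = m + j` inductively: the weights `j' > j` vanish there and
the weight `j' = j` is `2^j j! ≠ 0`). [folklore] -/
theorem freshWeight_coeff_eq {m N : ℕ} {a b : ℕ → ℕ}
    (h : ∀ d : ℕ, m ≤ d →
      ∑ j ∈ range N, a j * freshWeight d m j = ∑ j ∈ range N, b j * freshWeight d m j) :
    ∀ j, j < N → a j = b j := by
  have h' : ∀ d : ℕ, m ≤ d →
      ∑ j ∈ range N, ((a j : ℤ) - b j) * (freshWeight d m j : ℤ) = 0 := by
    intro d hd
    have := congrArg (Nat.cast : ℕ → ℤ) (h d hd)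
    push_cast at this
    simp only [sub_mul, sum_sub_distrib, this, sub_self]
  suffices hc : ∀ j, j < N → ((a j : ℤ) - b j) = 0 by
    intro j hj; have := hc j hj; omega
  intro j
  induction j using Nat.strong_induction_on with
  | _ j ih =>
    intro hj
    have hs := h' (m + j) (Nat.le_add_right _ _)
    rw [sum_eq_single j] at hs
    · have hw : (freshWeight (m + j) m j : ℤ) ≠ 0 := by
        rw [freshWeight, Nat.add_sub_cancel_left, Nat.descFactorial_self]
        positivity
      exact (mul_eq_zero.1 hs).resolve_right hw
    · intro i hi hij
      rcases lt_or_gt_of_ne hij with hlt | hgt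
      · rw [ih i hlt (lt_trans hlt hj), zero_mul]
      · rw [freshWeight, Nat.add_sub_cancel_left, (Nat.descFactorial_eq_zero_iff_lt).2 hgt]
        simp
    · intro hjN; exact absurd (mem_range.2 hj) hjN

/-! ### The symmetry lemma for `sawCodeG` -/

/-- The side conditions of `sawCodeG_symm`, all decidable: `q` is a permutation of `0, …, m-1`; the current
list `l` and every visited list have length `m`; box and code-width margins; no visited list is the origin;
and the numerals `C₁, L₁` / `C₂, L₂` / `L1` ARE the codes of the state / of its image under `actList q sg` /
the `ℓ¹` norm. [folklore] -/
def SymmHyp (n m D : ℕ) (l : List ℤ) (P : List (List ℤ)) (q : List ℕ) (sg : List Bool)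
    (C₁ C₂ L1 : ℕ) (L₁ L₂ : List ℕ) : Prop :=
  q.length = m ∧ (∀ a ∈ q, a < m) ∧ q.Nodup ∧ l.length = m ∧ (∀ p ∈ P, p.length = m) ∧ m + n ≤ D ∧
  n < sawR ∧ (∀ a ∈ l, a.natAbs + n < sawR) ∧ (∀ p ∈ P, ∀ a ∈ p, a.natAbs < sawR) ∧
  (∀ p ∈ P, ∃ a ∈ p, a ≠ 0) ∧
  (∀ a ∈ actList q sg l, a.natAbs + n < sawR) ∧ (∀ p ∈ P.map (actList q sg), ∀ a ∈ p, a.natAbs < sawR) ∧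
  (∀ p ∈ P.map (actList q sg), ∃ a ∈ p, a ≠ 0) ∧
  codeList l D = C₁ ∧ codeList (actList q sg l) D = C₂ ∧ (l.map Int.natAbs).sum = L1 ∧
  ((actList q sg l).map Int.natAbs).sum = L1 ∧
  P.map (fun p => codeList p D) = L₁ ∧ (P.map (actList q sg)).map (fun p => codeList p D) = L₂

/-- `SymmHyp` is decidable (it is checked by `decide` at each use). [folklore] -/
instance instDecidableSymmHyp (n m D : ℕ) (l : List ℤ) (P : List (List ℤ)) (q : List ℕ) (sg : List Bool)
    (C₁ C₂ L1 : ℕ) (L₁ L₂ : List ℕ) : Decidable (SymmHyp n m D l P q sg C₁ C₂ L1 L₁ L₂) := by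
  unfold SymmHyp; infer_instance

/-- **`W_m`-symmetry of the kernel values, coefficient by coefficient.**  If the state coded by `(C₂, L₂)` is the
image of the state coded by `(C₁, L₁)` under a signed permutation of the first `m` coordinates (side
conditions `SymmHyp`, decidable), then `sawCodeG n j m C₂ L1 (pathV L₂) L₂ = sawCodeG n j m C₁ L1 (pathV L₁) L₁`
for every `j`. [folklore] -/
theorem sawCodeG_symm {n m D : ℕ} {l : List ℤ} {P : List (List ℤ)} {q : List ℕ} {sg : List Bool}
    {C₁ C₂ L1 : ℕ} {L₁ L₂ : List ℕ} (h : SymmHyp n m D l P q sg C₁ C₂ L1 L₁ L₂) (j : ℕ) :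
    sawCodeG n j m C₂ L1 (pathV L₂) L₂ = sawCodeG n j m C₁ L1 (pathV L₁) L₁ := by
  obtain ⟨hq, hqm, hnd, hl, hP, hD, hn, hbox, hPbox, hP0, hbox₂, hPbox₂, hP0₂, hC₁, hC₂, hL1, hL1₂, hL₁, hL₂⟩ :=
    h
  subst hC₁ hC₂ hL1 hL₁ hL₂
  have hl₂ : (actList q sg l).length = m := by rw [length_actList, hq]
  have hP₂ : ∀ p ∈ P.map (actList q sg), p.length = m := by
    intro p hp
    obtain ⟨p₀, -, rfl⟩ := List.mem_map.1 hp
    rw [length_actList, hq]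
  have key : ∀ e : ℕ, m ≤ e →
      ∑ j ∈ range (n + 1), sawCodeG n j m (codeList (actList q sg l) D) ((l.map Int.natAbs).sum)
          (pathV ((P.map (actList q sg)).map fun p => codeList p D))
          ((P.map (actList q sg)).map fun p => codeList p D) * freshWeight e m j =
        ∑ j ∈ range (n + 1), sawCodeG n j m (codeList l D) ((l.map Int.natAbs).sum)
          (pathV (P.map fun p => codeList p D)) (P.map fun p => codeList p D) * freshWeight e m j := by
    intro e hme
    obtain ⟨π, ε, hact⟩ := exists_signedPerm_actList (d := e) sg hme hq hqm hnd
    rw [← sawCount_lists_eq_sum hme hl hP hD hbox hn hPbox hP0, ← hL1₂,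
      ← sawCount_lists_eq_sum hme hl₂ hP₂ hD hbox₂ hn hPbox₂ hP0₂, ← hact l hl,
      ← image_listSet_of_forall (fun p hp => hact p (hP p hp)), sawCount_signedPerm]
  by_cases hj : j < n + 1
  · exact freshWeight_coeff_eq key j hj
  · rw [sawCodeG_prune (by omega), sawCodeG_prune (by omega)]

end Literature.Probability.FitznerVanDerHofstad2017
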